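import Summits.Ventures.PercRepro.Night2LineHitCells

/-!
# night-2: THE RANK FAMILY ON ANY LINE WITH FOUR LINE POINTS (gen 39)

Gen 38's line theorem used the off-line sets `Y_O` with `rk (O ∖ Y_O) ≤ 1` (`O` itself and `O ∖ {y}`), whose targets have
`vCap = 1`, on a BASIS line with five line points.  With the four-point unloaded lemma the same family works on ANY line
`ℓ = cl {x, y}` (`q = |Q′ ∩ ℓ|`) with `|Y_D| ≥ 4` and `|Y_O| > q`: `lineRankIncome q d i := Σ_{j=4}^{d} C(d, j) · 3 /
lineFaceBound (j + q) (i + 5 − q)` per family.  **`basis_pair_fair_of_line_rank_families`** (any family of such `Y_O`),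
**`basis_pair_fair_of_line_rank_plus`** (`O` and the `O ∖ {y}`: `lineRankIncome q d k + k · lineRankIncome q d (k − 1) ≥ 1`),
**`basis_pair_fair_of_line_rank_one`** (`O` alone).  Cells: `(8, 3)` (`q ≤ 1`: `4.70 / 5.39`; `q = 2`: `1.12`), `(7, 4)`
(`1.67 / 1.85 / 2.16`), `(8, 2)` (`q ≤ 1`: `1.10 / 1.26`), `(7, 3)` (`q ≤ 1`: `1.27 / 1.44`): **`basis_pair_fair_of_line_rank_cells`**.
Paper: proofs/NIGHT-2-g39.md §4.
-/

namespace PercRepro.Shadow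

open PercRepro.ThmH PercRepro.PerFlat

variable {α : Type*} [DecidableEq α] {M : Matroid α} [M.Finite] {G : Finset α}

/-- The rank-family income of one off-line set of size `i`: `Σ_{j=4}^{d} C(d, j) · 3 / lineFaceBound (j + q) (i + 5 − q)`. -/
noncomputable def lineRankIncome (q d i : ℕ) : ℚ :=
  ∑ j ∈ Finset.range (d + 1), if 4 ≤ j then
    ((d.choose j : ℕ) : ℚ) * (3 / ((lineFaceBound (j + q) (i + 5 - q) : ℕ) : ℚ)) else 0

/-- Every summand of `lineRankIncome` is nonnegative. -/
theorem lineRankIncome_term_nonneg (q d i j : ℕ) :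
    (0 : ℚ) ≤ (if 4 ≤ j then ((d.choose j : ℕ) : ℚ) * (3 / ((lineFaceBound (j + q) (i + 5 - q) : ℕ) : ℚ)) else 0) := by
  split_ifs
  · positivity
  · exact le_rfl

/-- `lineRankIncome` is monotone in the number of line points. -/
theorem lineRankIncome_mono_left (q i : ℕ) {d d' : ℕ} (h : d ≤ d') :
    lineRankIncome q d i ≤ lineRankIncome q d' i := by
  unfold lineRankIncome
  calc ∑ j ∈ Finset.range (d + 1),
        (if 4 ≤ j then ((d.choose j : ℕ) : ℚ) * (3 / ((lineFaceBound (j + q) (i + 5 - q) : ℕ) : ℚ)) else 0)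
      ≤ ∑ j ∈ Finset.range (d + 1),
        (if 4 ≤ j then ((d'.choose j : ℕ) : ℚ) * (3 / ((lineFaceBound (j + q) (i + 5 - q) : ℕ) : ℚ)) else 0) := by
        apply Finset.sum_le_sum
        intro j _
        split_ifs
        · apply mul_le_mul_of_nonneg_right _ (by positivity)
          exact_mod_cast Nat.choose_le_choose j h
        · exact le_rfl
    _ ≤ ∑ j ∈ Finset.range (d' + 1),
        (if 4 ≤ j then ((d'.choose j : ℕ) : ℚ) * (3 / ((lineFaceBound (j + q) (i + 5 - q) : ℕ) : ℚ)) else 0) := by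
        apply Finset.sum_le_sum_of_subset_of_nonneg
        · intro j hj
          rw [Finset.mem_range] at hj ⊢
          omega
        · intro j _ _
          exact lineRankIncome_term_nonneg q d' i j

/-- **The per-target bound of the rank family**: `Y_D ⊆ W ∩ cl {x, y}` with `|Y_D| ≥ 4`, `Y_O ⊆ W ∖ cl {x, y}` with
`|Y_O| > q` and `rk ((W ∖ cl {x, y}) ∖ Y_O) ≤ 1` give `vCap T = 1` and `faceSum T ≤ lineFaceBound (|Y_D| + q) (|Y_O| + 5 − q) / 3`. -/
theorem line_rank_term (hG : G ∈ flatsQ M (5 + 1)) (hd : (gr M \ G).card = 2)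
    (hk : kColoops M G = 1) (hs : ∀ e ∈ gr M, ∀ f ∈ gr M, e ≠ f → rkN M {e, f} = 2)
    (hl : ∀ e ∈ gr M, M.Indep {e}) (hnf : fatClosures M 5 G 2 = ∅) {B : Finset α}
    (hB : B ∈ thinMembers M 5 G) (hnP : ¬ bigP M G B) {z : α} (hz : z ∈ G \ clF M B)
    (hl0 : loss M 5 G B z ≠ 0) {x y : α}
    {YD YO : Finset α} (hYD : YD ⊆ (G \ insert z B) ∩ clF M {x, y}) (h4 : 4 ≤ YD.card)
    (hYO : YO ⊆ (G \ insert z B) \ clF M {x, y})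
    (hq : ((insert z B \ coloops M G) ∩ clF M {x, y}).card < YO.card)
    (hrk : rkN M (((G \ insert z B) \ clF M {x, y}) \ YO) ≤ 1) :
    3 / ((lineFaceBound (YD.card + ((insert z B \ coloops M G) ∩ clF M {x, y}).card)
      (YO.card + 5 - ((insert z B \ coloops M G) ∩ clF M {x, y}).card) : ℕ) : ℚ) ≤
      vCap M G (insert z B ∪ (YD ∪ YO)) / faceSum M G (insert z B ∪ (YD ∪ YO)) := by
  have hfat : (fatClosures M 5 G 2).card ≤ 1 := by
    rw [hnf, Finset.card_empty]
    exact zero_le_one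
  have hQG : insert z B ⊆ G :=
    Finset.insert_subset (Finset.mem_sdiff.1 hz).1 (subset_G_of_mem_thinMembers hB)
  have hind : M.Indep ((insert z B \ coloops M G : Finset α) : Set α) :=
    (indep_insert_of_basis_pair hG hd hk hB hnP hz).subset (by exact_mod_cast (Finset.sdiff_subset))
  have hq2 := card_inter_clF_pair_le_two_of_indep hind (a := x) (b := y)
  obtain ⟨-, hQ'5⟩ := rkN_insert_sdiff_coloops_eq_five hG hd hk hB hnP hz
  have hYDW : YD ⊆ G \ insert z B := hYD.trans Finset.inter_subset_left
  have hYOW : YO ⊆ G \ insert z B := hYO.trans Finset.sdiff_subset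
  have hYW : YD ∪ YO ⊆ G \ insert z B := Finset.union_subset hYDW hYOW
  have hT : insert z B ∪ (YD ∪ YO) ∈ tgtSets M 5 G B z := by
    rw [tgtSets_eq_image hG (mem_thinMembers.1 hB).1 hz, Finset.mem_image]
    refine ⟨YD ∪ YO, Finset.mem_filter.2 ⟨Finset.mem_powerset.2 hYW, ?_⟩, rfl⟩
    exact Finset.Nonempty.mono Finset.subset_union_left (Finset.card_pos.1 (by omega))
  have hTG : insert z B ∪ (YD ∪ YO) ⊆ G := Finset.union_subset hQG (hYW.trans Finset.sdiff_subset)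
  -- unloaded
  have hdl : dload M 5 G (bigP M G) (dshGT2 M 5 G) (insert z B ∪ (YD ∪ YO)) = 0 :=
    dload_eq_zero_of_line_target_four hG hd hk hs hl hfat hB hnP hz {x, y} hYD h4 hYO hq
  -- the complement has rank `≤ 3`
  have hcomp : G \ (insert z B ∪ (YD ∪ YO)) ⊆
      (((G \ insert z B) ∩ clF M {x, y}) \ YD) ∪ (((G \ insert z B) \ clF M {x, y}) \ YO) := by
    intro e he
    simp only [Finset.mem_sdiff, Finset.mem_union, not_or] at he
    obtain ⟨heG, heQ, heYD, heYO⟩ := he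
    simp only [Finset.mem_union, Finset.mem_sdiff, Finset.mem_inter]
    by_cases hel : e ∈ clF M {x, y}
    · exact Or.inl ⟨⟨⟨heG, heQ⟩, hel⟩, heYD⟩
    · exact Or.inr ⟨⟨⟨heG, heQ⟩, hel⟩, heYO⟩
  have hrk3 : rkN M (G \ (insert z B ∪ (YD ∪ YO))) ≤ 3 := by
    refine le_trans (rkN_mono hcomp) ?_
    refine le_trans (rkN_union_le_add _ _) ?_
    have hD2 : rkN M (((G \ insert z B) ∩ clF M {x, y}) \ YD) ≤ 2 := by
      refine le_trans (rkN_le_of_subset_clF' (Finset.sdiff_subset.trans Finset.inter_subset_right)) ?_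
      exact le_trans (rkN_le_card _) Finset.card_le_two
    omega
  have hv : vCap M G (insert z B ∪ (YD ∪ YO)) = 1 := vCap_eq_one_of_rkN_sdiff_le_three hd hdl hrk3
  have hpos := faceSum_pos_of_mem_tgtSets hG hd hk hB hnP hz hl0 hT
  have hfs := faceSum_le_third_mul_lineCount hG hd hk hnf hTG x y
  have hT'K := union_sdiff_coloops_eq_of_subset hG hd hB (z := z) hYW
  have hcard_in : (((insert z B ∪ (YD ∪ YO)) \ coloops M G) ∩ clF M {x, y}).card ≤
      YD.card + ((insert z B \ coloops M G) ∩ clF M {x, y}).card := by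
    rw [hT'K, Finset.union_inter_distrib_right, Finset.union_inter_distrib_right]
    have hYOl : YO ∩ clF M {x, y} = ∅ := by
      rw [Finset.eq_empty_iff_forall_notMem]
      intro e he
      exact (Finset.mem_sdiff.1 (hYO (Finset.mem_inter.1 he).1)).2 (Finset.mem_inter.1 he).2
    rw [hYOl, Finset.union_empty]
    refine le_trans (Finset.card_union_le _ _) ?_
    have := Finset.card_le_card (Finset.inter_subset_left : YD ∩ clF M {x, y} ⊆ YD)
    omega
  have hcard_off : (((insert z B ∪ (YD ∪ YO)) \ coloops M G) \ clF M {x, y}).card ≤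
      YO.card + 5 - ((insert z B \ coloops M G) ∩ clF M {x, y}).card := by
    rw [hT'K, Finset.union_sdiff_distrib, Finset.union_sdiff_distrib]
    have hYDl : YD \ clF M {x, y} = ∅ := by
      rw [Finset.eq_empty_iff_forall_notMem]
      intro e he
      exact (Finset.mem_sdiff.1 he).2 (Finset.mem_inter.1 (hYD (Finset.mem_sdiff.1 he).1)).2
    rw [hYDl, Finset.empty_union]
    have hQ'off := Finset.card_sdiff_add_card_inter (insert z B \ coloops M G) (clF M {x, y})
    refine le_trans (Finset.card_union_le _ _) ?_
    have := Finset.card_le_card (Finset.sdiff_subset : YO \ clF M {x, y} ⊆ YO)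
    omega
  have hfs' : faceSum M G (insert z B ∪ (YD ∪ YO)) ≤ 1 / 3 * ((lineFaceBound (YD.card +
      ((insert z B \ coloops M G) ∩ clF M {x, y}).card)
      (YO.card + 5 - ((insert z B \ coloops M G) ∩ clF M {x, y}).card) : ℕ) : ℚ) := by
    refine le_trans hfs ?_
    apply mul_le_mul_of_nonneg_left _ (by norm_num)
    exact_mod_cast lineFaceBound_mono hcard_in hcard_off
  have hLpos : (0 : ℚ) < ((lineFaceBound (YD.card + ((insert z B \ coloops M G) ∩ clF M {x, y}).card)
      (YO.card + 5 - ((insert z B \ coloops M G) ∩ clF M {x, y}).card) : ℕ) : ℚ) := by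
    exact_mod_cast lineFaceBound_pos (by omega)
  rw [hv, div_le_div_iff₀ hLpos hpos]
  linarith

/-- **The rank-family targets of one off-line set are targets, and their income is at least
`lineRankIncome q d |Y_O|`.** -/
theorem line_rank_targets_subset_and_income (hG : G ∈ flatsQ M (5 + 1)) (hd : (gr M \ G).card = 2)
    (hk : kColoops M G = 1) (hs : ∀ e ∈ gr M, ∀ f ∈ gr M, e ≠ f → rkN M {e, f} = 2)
    (hl : ∀ e ∈ gr M, M.Indep {e}) (hnf : fatClosures M 5 G 2 = ∅) {B : Finset α}
    (hB : B ∈ thinMembers M 5 G) (hnP : ¬ bigP M G B) {z : α} (hz : z ∈ G \ clF M B)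
    (hl0 : loss M 5 G B z ≠ 0) {x y : α} {YO : Finset α}
    (hYO : YO ⊆ (G \ insert z B) \ clF M {x, y})
    (hq : ((insert z B \ coloops M G) ∩ clF M {x, y}).card < YO.card)
    (hrk : rkN M (((G \ insert z B) \ clF M {x, y}) \ YO) ≤ 1) :
    ((((G \ insert z B) ∩ clF M {x, y}).powerset.filter (fun YD => 4 ≤ YD.card)).image
        (fun YD => insert z B ∪ (YD ∪ YO))) ⊆ tgtSets M 5 G B z ∧
      lineRankIncome ((insert z B \ coloops M G) ∩ clF M {x, y}).card ((G \ insert z B) ∩ clF M {x, y}).card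
        YO.card ≤
      ∑ T ∈ (((G \ insert z B) ∩ clF M {x, y}).powerset.filter (fun YD => 4 ≤ YD.card)).image
        (fun YD => insert z B ∪ (YD ∪ YO)), vCap M G T / faceSum M G T := by
  have hQG : insert z B ⊆ G :=
    Finset.insert_subset (Finset.mem_sdiff.1 hz).1 (subset_G_of_mem_thinMembers hB)
  set D : Finset α := (G \ insert z B) ∩ clF M {x, y} with hDdef
  set Ds : Finset (Finset α) := D.powerset.filter (fun YD => 4 ≤ YD.card) with hDs
  set 𝒯 : Finset (Finset α) := Ds.image (fun YD => insert z B ∪ (YD ∪ YO)) with h𝒯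
  have hmemD : ∀ YD ∈ Ds, YD ⊆ D ∧ 4 ≤ YD.card := fun YD hYD => by
    have := Finset.mem_filter.1 hYD
    exact ⟨Finset.mem_powerset.1 this.1, this.2⟩
  have hDW : D ⊆ G \ insert z B := Finset.inter_subset_left
  have hYOW : YO ⊆ G \ insert z B := hYO.trans Finset.sdiff_subset
  have h𝒯sub : 𝒯 ⊆ tgtSets M 5 G B z := by
    intro T hT
    rw [h𝒯, Finset.mem_image] at hT
    obtain ⟨YD, hYD, rfl⟩ := hT
    obtain ⟨hYDD, hYD4⟩ := hmemD YD hYD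
    rw [tgtSets_eq_image hG (mem_thinMembers.1 hB).1 hz, Finset.mem_image]
    refine ⟨YD ∪ YO, Finset.mem_filter.2 ⟨Finset.mem_powerset.2 (Finset.union_subset (hYDD.trans hDW) hYOW), ?_⟩,
      rfl⟩
    exact Finset.Nonempty.mono Finset.subset_union_left (Finset.card_pos.1 (by omega))
  have hinj : Set.InjOn (fun YD => insert z B ∪ (YD ∪ YO)) (Ds : Set (Finset α)) := by
    intro Y₁ hY₁ Y₂ hY₂ heq
    rw [Finset.mem_coe] at hY₁ hY₂
    have key : ∀ YD ∈ Ds, (insert z B ∪ (YD ∪ YO)) ∩ D = YD := by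
      intro YD hYD
      ext e
      rw [Finset.mem_inter, Finset.mem_union, Finset.mem_union]
      constructor
      · rintro ⟨he | he | he, heD⟩
        · exact absurd he (Finset.mem_sdiff.1 (hDW heD)).2
        · exact he
        · exact absurd (Finset.mem_inter.1 heD).2 (Finset.mem_sdiff.1 (hYO he)).2
      · intro he
        exact ⟨Or.inr (Or.inl he), (hmemD YD hYD).1 he⟩
    have h1 := key Y₁ hY₁
    have h2 := key Y₂ hY₂
    simp only at heq
    rw [← h1, ← h2, heq]
  have hterm : ∀ YD ∈ Ds, 3 / ((lineFaceBound (YD.card + ((insert z B \ coloops M G) ∩ clF M {x, y}).card)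
      (YO.card + 5 - ((insert z B \ coloops M G) ∩ clF M {x, y}).card) : ℕ) : ℚ) ≤
      vCap M G (insert z B ∪ (YD ∪ YO)) / faceSum M G (insert z B ∪ (YD ∪ YO)) := by
    intro YD hYD
    obtain ⟨hYDD, hYD4⟩ := hmemD YD hYD
    exact line_rank_term hG hd hk hs hl hnf hB hnP hz hl0 hYDD hYD4 hYO hq hrk
  have hsum𝒯 : ∑ YD ∈ Ds, 3 / ((lineFaceBound (YD.card + ((insert z B \ coloops M G) ∩ clF M {x, y}).card)
      (YO.card + 5 - ((insert z B \ coloops M G) ∩ clF M {x, y}).card) : ℕ) : ℚ) ≤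
      ∑ T ∈ 𝒯, vCap M G T / faceSum M G T := by
    rw [h𝒯, Finset.sum_image hinj]
    exact Finset.sum_le_sum hterm
  refine ⟨h𝒯sub, le_trans ?_ hsum𝒯⟩
  unfold lineRankIncome
  rw [hDs, Finset.sum_filter]
  rw [Finset.sum_powerset_apply_card (fun j => if 4 ≤ j then
    3 / ((lineFaceBound (j + ((insert z B \ coloops M G) ∩ clF M {x, y}).card)
      (YO.card + 5 - ((insert z B \ coloops M G) ∩ clF M {x, y}).card) : ℕ) : ℚ) else 0)]
  apply le_of_eq
  apply Finset.sum_congr rfl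
  intro j _
  rw [nsmul_eq_mul]
  split_ifs
  · rfl
  · rw [mul_zero]

/-- **The rank-family theorem on any line**: a family `𝒴` of off-line sets `Y_O ⊆ W ∖ cl {x, y}` with `|Y_O| > q` and
`rk ((W ∖ cl {x, y}) ∖ Y_O) ≤ 1`, and `1 ≤ Σ_{Y_O ∈ 𝒴} lineRankIncome q d |Y_O|` ⇒ fair. -/
theorem basis_pair_fair_of_line_rank_families (hG : G ∈ flatsQ M (5 + 1)) (hd : (gr M \ G).card = 2)
    (hk : kColoops M G = 1) (hs : ∀ e ∈ gr M, ∀ f ∈ gr M, e ≠ f → rkN M {e, f} = 2)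
    (hl : ∀ e ∈ gr M, M.Indep {e}) (hnf : fatClosures M 5 G 2 = ∅) {B : Finset α}
    (hB : B ∈ thinMembers M 5 G) (hnP : ¬ bigP M G B) {z : α} (hz : z ∈ G \ clF M B)
    (hl0 : loss M 5 G B z ≠ 0) {x y : α} {𝒴 : Finset (Finset α)}
    (h𝒴 : ∀ YO ∈ 𝒴, YO ⊆ (G \ insert z B) \ clF M {x, y} ∧
      ((insert z B \ coloops M G) ∩ clF M {x, y}).card < YO.card ∧
      rkN M (((G \ insert z B) \ clF M {x, y}) \ YO) ≤ 1)
    (hsum : 1 ≤ ∑ YO ∈ 𝒴, lineRankIncome ((insert z B \ coloops M G) ∩ clF M {x, y}).card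
      ((G \ insert z B) ∩ clF M {x, y}).card YO.card) :
    loss M 5 G B z ≤ rhoL M 5 G B z * lossIncomeH M 5 G (bigP M G) (dshGT2 M 5 G) B z := by
  have hfat : (fatClosures M 5 G 2).card ≤ 1 := by
    rw [hnf, Finset.card_empty]
    exact zero_le_one
  set D : Finset α := (G \ insert z B) ∩ clF M {x, y} with hDdef
  set Ds : Finset (Finset α) := D.powerset.filter (fun YD => 4 ≤ YD.card) with hDs
  set fam : Finset α → Finset (Finset α) := fun YO => Ds.image (fun YD => insert z B ∪ (YD ∪ YO)) with hfam
  have hmemD : ∀ YD ∈ Ds, YD ⊆ D := fun YD hYD => Finset.mem_powerset.1 (Finset.mem_filter.1 hYD).1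
  have hrec : ∀ YO ∈ 𝒴, ∀ YD ∈ Ds,
      (insert z B ∪ (YD ∪ YO)) ∩ ((G \ insert z B) \ clF M {x, y}) = YO := by
    intro YO hYO YD hYD
    obtain ⟨hYOsub, -, -⟩ := h𝒴 YO hYO
    ext e
    simp only [Finset.mem_inter, Finset.mem_union, Finset.mem_sdiff]
    constructor
    · rintro ⟨he | he | he, ⟨heG, heQ⟩, hel⟩
      · exact absurd he heQ
      · exact absurd (Finset.mem_inter.1 (hmemD YD hYD he)).2 hel
      · exact he
    · intro he
      have he' := hYOsub he
      rw [Finset.mem_sdiff, Finset.mem_sdiff] at he'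
      exact ⟨Or.inr (Or.inr he), he'.1, he'.2⟩
  have hdisj : (𝒴 : Set (Finset α)).PairwiseDisjoint fam := by
    intro Y₁ hY₁ Y₂ hY₂ hne
    rw [Finset.mem_coe] at hY₁ hY₂
    rw [Function.onFun, Finset.disjoint_left]
    intro T hT₁ hT₂
    rw [hfam, Finset.mem_image] at hT₁ hT₂
    obtain ⟨YD₁, hYD₁, rfl⟩ := hT₁
    obtain ⟨YD₂, hYD₂, heq⟩ := hT₂
    have h1 := hrec Y₁ hY₁ YD₁ hYD₁
    have h2 := hrec Y₂ hY₂ YD₂ hYD₂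
    rw [heq] at h2
    exact hne (h1.symm.trans h2)
  have hsub : 𝒴.biUnion fam ⊆ tgtSets M 5 G B z := by
    apply Finset.biUnion_subset.2
    intro YO hYO
    obtain ⟨hYOsub, hq, hrk⟩ := h𝒴 YO hYO
    exact (line_rank_targets_subset_and_income hG hd hk hs hl hnf hB hnP hz hl0 hYOsub hq hrk).1
  apply basis_pair_fair_of_vCap_face_sum_subfamily hG hd hk hs hl hfat hB hnP hz hl0 hsub
  rw [Finset.sum_biUnion hdisj]
  refine hsum.trans (Finset.sum_le_sum ?_)
  intro YO hYO
  obtain ⟨hYOsub, hq, hrk⟩ := h𝒴 YO hYO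
  exact (line_rank_targets_subset_and_income hG hd hk hs hl hnf hB hnP hz hl0 hYOsub hq hrk).2

/-- **The rank family `O` alone**: `|O| = k > q`, `d₀ ≤ d`, `1 ≤ lineRankIncome q d₀ k` ⇒ fair. -/
theorem basis_pair_fair_of_line_rank_one (hG : G ∈ flatsQ M (5 + 1)) (hd : (gr M \ G).card = 2)
    (hk : kColoops M G = 1) (hs : ∀ e ∈ gr M, ∀ f ∈ gr M, e ≠ f → rkN M {e, f} = 2)
    (hl : ∀ e ∈ gr M, M.Indep {e}) (hnf : fatClosures M 5 G 2 = ∅) {B : Finset α}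
    (hB : B ∈ thinMembers M 5 G) (hnP : ¬ bigP M G B) {z : α} (hz : z ∈ G \ clF M B)
    (hl0 : loss M 5 G B z ≠ 0) {x y : α} {d₀ k : ℕ}
    (hoff : ((G \ insert z B) \ clF M {x, y}).card = k)
    (hq : ((insert z B \ coloops M G) ∩ clF M {x, y}).card < k)
    (hon : d₀ ≤ ((G \ insert z B) ∩ clF M {x, y}).card)
    (hnum : 1 ≤ lineRankIncome ((insert z B \ coloops M G) ∩ clF M {x, y}).card d₀ k) :
    loss M 5 G B z ≤ rhoL M 5 G B z * lossIncomeH M 5 G (bigP M G) (dshGT2 M 5 G) B z := by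
  apply basis_pair_fair_of_line_rank_families hG hd hk hs hl hnf hB hnP hz hl0
    (𝒴 := {(G \ insert z B) \ clF M {x, y}})
  · intro YO hYO
    rw [Finset.mem_singleton] at hYO
    subst hYO
    refine ⟨Finset.Subset.refl _, by omega, ?_⟩
    rw [Finset.sdiff_self]
    have := rkN_le_card (M := M) (∅ : Finset α)
    rw [Finset.card_empty] at this
    omega
  · rw [Finset.sum_singleton, hoff]
    exact le_trans hnum (lineRankIncome_mono_left _ _ hon)

/-- **The rank families `O` and `O ∖ {y}`**: `|O| = k`, `q + 1 < k`, `d₀ ≤ d`,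
`1 ≤ lineRankIncome q d₀ k + k · lineRankIncome q d₀ (k − 1)` ⇒ fair. -/
theorem basis_pair_fair_of_line_rank_plus (hG : G ∈ flatsQ M (5 + 1)) (hd : (gr M \ G).card = 2)
    (hk : kColoops M G = 1) (hs : ∀ e ∈ gr M, ∀ f ∈ gr M, e ≠ f → rkN M {e, f} = 2)
    (hl : ∀ e ∈ gr M, M.Indep {e}) (hnf : fatClosures M 5 G 2 = ∅) {B : Finset α}
    (hB : B ∈ thinMembers M 5 G) (hnP : ¬ bigP M G B) {z : α} (hz : z ∈ G \ clF M B)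
    (hl0 : loss M 5 G B z ≠ 0) {x y : α} {d₀ k : ℕ}
    (hoff : ((G \ insert z B) \ clF M {x, y}).card = k)
    (hq : ((insert z B \ coloops M G) ∩ clF M {x, y}).card + 1 < k)
    (hon : d₀ ≤ ((G \ insert z B) ∩ clF M {x, y}).card)
    (hnum : 1 ≤ lineRankIncome ((insert z B \ coloops M G) ∩ clF M {x, y}).card d₀ k +
      (k : ℚ) * lineRankIncome ((insert z B \ coloops M G) ∩ clF M {x, y}).card d₀ (k - 1)) :
    loss M 5 G B z ≤ rhoL M 5 G B z * lossIncomeH M 5 G (bigP M G) (dshGT2 M 5 G) B z := by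
  set O : Finset α := (G \ insert z B) \ clF M {x, y} with hOdef
  set 𝒴 : Finset (Finset α) := insert O (O.image (fun u => O.erase u)) with h𝒴def
  have hOnot : O ∉ O.image (fun u => O.erase u) := by
    intro h
    rw [Finset.mem_image] at h
    obtain ⟨u, hu, heu⟩ := h
    have := Finset.card_erase_of_mem hu
    rw [heu] at this
    omega
  have hinj : Set.InjOn (fun u => O.erase u) (O : Set α) := by
    intro u₁ hu₁ u₂ hu₂ heq
    rw [Finset.mem_coe] at hu₁ hu₂
    simp only at heq
    by_contra hne
    have : u₁ ∈ O.erase u₂ := Finset.mem_erase.2 ⟨hne, hu₁⟩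
    rw [← heq] at this
    exact (Finset.mem_erase.1 this).1 rfl
  apply basis_pair_fair_of_line_rank_families hG hd hk hs hl hnf hB hnP hz hl0 (𝒴 := 𝒴)
  · intro YO hYO
    rw [h𝒴def, Finset.mem_insert, Finset.mem_image] at hYO
    rcases hYO with rfl | ⟨u, hu, rfl⟩
    · refine ⟨Finset.Subset.refl _, by omega, ?_⟩
      rw [Finset.sdiff_self]
      have := rkN_le_card (M := M) (∅ : Finset α)
      rw [Finset.card_empty] at this
      omega
    · refine ⟨Finset.erase_subset _ _, ?_, ?_⟩
      · rw [Finset.card_erase_of_mem hu]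
        omega
      · have hsd : O \ O.erase u = {u} := by
          ext e
          simp only [Finset.mem_sdiff, Finset.mem_erase, Finset.mem_singleton, not_and]
          constructor
          · rintro ⟨heO, h⟩
            by_contra heu
            exact h heu heO
          · rintro rfl
            exact ⟨hu, fun h _ => h rfl⟩
        rw [hsd]
        exact le_trans (rkN_le_card _) (by simp)
  · rw [h𝒴def, Finset.sum_insert hOnot, Finset.sum_image hinj]
    have hconst : ∑ u ∈ O, lineRankIncome ((insert z B \ coloops M G) ∩ clF M {x, y}).card
        ((G \ insert z B) ∩ clF M {x, y}).card (O.erase u).card =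
        (k : ℚ) * lineRankIncome ((insert z B \ coloops M G) ∩ clF M {x, y}).card
          ((G \ insert z B) ∩ clF M {x, y}).card (k - 1) := by
      rw [Finset.sum_congr rfl (fun u hu => by rw [Finset.card_erase_of_mem hu, hoff]),
        Finset.sum_const, nsmul_eq_mul, hoff]
    rw [hconst, hoff]
    have h1 := lineRankIncome_mono_left ((insert z B \ coloops M G) ∩ clF M {x, y}).card k hon
    have h2 := lineRankIncome_mono_left ((insert z B \ coloops M G) ∩ clF M {x, y}).card (k - 1) hon
    have hk0 : (0 : ℚ) ≤ (k : ℚ) := by positivity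
    nlinarith

end PercRepro.Shadow
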